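import Mathlib.Topology.Sheaves.Flasque
import Mathlib.Topology.Sheaves.Functors
import Mathlib.CategoryTheory.Sites.SheafCohomology.Basic
import Mathlib.CategoryTheory.Sites.ConstantSheaf
import Mathlib.CategoryTheory.Abelian.GrothendieckCategory.HasExt
import Mathlib.Topology.KrullDimension
import Mathlib.Topology.NoetherianSpace
import HarnessLib

/-!
# Grothendieck's vanishing theorem and the flasque-sheaf lemmas leading to it (named facts)

Topic: `Literature/AlgebraicGeometry/Motives` (support file for `Differentials.lean`, whose fact
`Literature.AlgebraicGeometry.Motives.subsingleton_structureSheafCohomology_of_lt` — `H^q(X, 𝒪_X) = 0` for a noetherian scheme of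
dimension `< q` — is the case `ℱ = 𝒪_X` of the theorem below).

This file vendors, as named facts (`def … : Prop`, no proofs), the chain of results of
Hartshorne, *Algebraic Geometry*, III.2 (pp. 207–211) that make up the proof of

**Theorem III.2.7 (Grothendieck).** Let `X` be a noetherian topological space of dimension `n`. Then
for all `i > n` and all sheaves of abelian groups `ℱ` on `X`, `H^i(X, ℱ) = 0`.

in the setting of Mathlib's sheaf cohomology `Sheaf.H F i = Ext^i(ℤ_X, F)` (an `Ext` group in the
Grothendieck abelian category of abelian sheaves on the small site `Opens X`; `Sheaf.H F i : Type u` for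
`X : TopCat.{u}`), Mathlib's flasque sheaves `TopCat.Sheaf.IsFlasque` (which already provides
II, Ex. 1.16(b),(c): `IsFlasque.epi_of_shortExact`, `IsFlasque.of_shortExact_of_isFlasque₁₂`) and
Mathlib's `topologicalKrullDim` (supremum of lengths of chains of irreducible closed subsets, which is
Hartshorne's `dim X`, I.1, p. 5).

The dependency graph of the printed proof (Hartshorne III.2, pp. 207–211):

* `injective_isFlasque` (III.2.4, case `𝒪_X = ℤ`): injective abelian sheaves are flasque;
* `isFlasque_subsingleton_H` (III.2.5): flasque sheaves are `Γ`-acyclic — from III.2.4, enough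
  injectives, II Ex. 1.16(b),(c) and the long exact sequence;
* `isFlasque_constantSheaf` (II, Ex. 1.16(a)): a constant sheaf on an irreducible space is flasque;
* `preservesColimitsOfShape_sheafToPresheaf` (II, Ex. 1.11): on a noetherian space a direct limit of
  sheaves is computed sectionwise;
* `isFlasque_colimit` (III.2.8): on a noetherian space a direct limit of flasque sheaves is flasque
  — from II, Ex. 1.11 and exactness of direct limits of abelian groups;
* `preservesColimitsOfShape_functorH` (III.2.9): on a noetherian space cohomology commutes with
  direct limits — from III.2.5, III.2.8 and II, Ex. 1.11;
* `H_pushforward_of_isClosedEmbedding` (III.2.10): `H^i(Y, ℱ) = H^i(X, j_* ℱ)` for a closed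
  subspace `j : Y ↪ X` — from III.2.5 and flasque resolutions;
* `grothendieckVanishing` (III.2.7): from all of the above by induction on `dim X`
  (Steps 1–5, pp. 210–211, using the dévissage `0 → ℱ_U → ℱ → ℱ_Y → 0` of II, Ex. 1.19).

Each fact is stated for sheaves of abelian groups on a topological space `X : TopCat.{u}` with
values in `AddCommGrpCat.{u}`. Discharges (sorry-free theorems `<fact>_holds : <fact>`, same directory):
`injective_isFlasque_holds` (III.2.4) and `isFlasque_subsingleton_H_holds` (III.2.5), proved in
`FlasqueCohomology.lean`; `isFlasque_constantSheaf_holds` (II Ex. 1.16(a)), proved in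
`ConstantFlasque.lean`; `preservesColimitsOfShape_sheafToPresheaf_holds` (II Ex. 1.11) and
`isFlasque_colimit_holds` (III.2.8), in `DirectedColimits.lean`; the vanishing form of III.2.9 used in
the proof of III.2.7, `subsingleton_H_succ_of_isColimit`, in `CohomologyColimits.lean`; and
`grothendieckVanishing_holds` (III.2.7) in `GrothendieckVanishingProofs.lean` (which also hosts the
first three `_holds` wrappers), following the printed Steps 1–5 on the fixed ambient space with sheaves
supported on closed subsets (`SupportedSheaves.lean`) in place of III.2.10.
`preservesColimitsOfShape_functorH` (III.2.9 as an isomorphism statement) and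
`H_pushforward_of_isClosedEmbedding` (III.2.10) remain named facts without discharge.

Sources: R. Hartshorne, *Algebraic Geometry*, GTM 52 (1977), II.1 and III.2;
A. Grothendieck, *Sur quelques points d'algèbre homologique*, Tôhoku Math. J. 9 (1957), 3.6.5.
-/

open CategoryTheory TopologicalSpace Opposite Limits

universe u

namespace Literature.AlgebraicGeometry.Motives

/-- **Hartshorne III.2.4** (for the ringed space `(X, ℤ)`, i.e. for sheaves of abelian groups, which is
the case used in III.2.5): an injective object of the category `𝔄𝔟(X)` of sheaves of abelian groups on a
topological space `X` is flasque (all restriction maps are surjective).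
Printed statement: "If `(X, 𝒪_X)` is a ringed space, any injective `𝒪_X`-module is flasque."
[cite: Hartshorne1977, III.2.4] -/
def injective_isFlasque : Prop :=
  ∀ (X : TopCat.{u}) (I : TopCat.Sheaf AddCommGrpCat.{u} X), Injective I → I.IsFlasque

/-- **Hartshorne III.2.5**: if `ℱ` is a flasque sheaf (of abelian groups) on a topological space `X`,
then `H^i(X, ℱ) = 0` for all `i > 0`. Here `H^i(X, ℱ)` is Mathlib's `Sheaf.H ℱ i`
(`= Ext^i(ℤ_X, ℱ)` in `𝔄𝔟(X)`, the derived functors of `Γ(X, ·) = Hom(ℤ_X, ·)`).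
[cite: Hartshorne1977, III.2.5] -/
def isFlasque_subsingleton_H : Prop :=
  ∀ (X : TopCat.{u}) (F : TopCat.Sheaf AddCommGrpCat.{u} X) [F.IsFlasque] (i : ℕ), 0 < i →
    Subsingleton (F.H i)

/-- **Hartshorne II, Ex. 1.16(a)**: a constant sheaf on an irreducible topological space is flasque.
(The constant sheaf with value `A` is the sheaf associated to the constant presheaf `U ↦ A`,
Hartshorne II.1.0.3, i.e. Mathlib's `constantSheaf`.)
[cite: Hartshorne1977, II Ex. 1.16(a)] -/
def isFlasque_constantSheaf : Prop :=
  ∀ (X : TopCat.{u}) [IrreducibleSpace X] (A : AddCommGrpCat.{u}),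
    TopCat.Sheaf.IsFlasque ((constantSheaf (Opens.grothendieckTopology X) AddCommGrpCat.{u}).obj A)

/-- **Hartshorne II, Ex. 1.11**: let `(ℱ_i)` be a direct system of sheaves on a noetherian topological
space `X`; then the presheaf `U ↦ lim→ ℱ_i(U)` is already a sheaf, in particular
`Γ(X, lim→ ℱ_i) = lim→ Γ(X, ℱ_i)`. Stated as: the forgetful functor from sheaves of abelian groups on
`X` to presheaves preserves colimits indexed by directed sets (so that the colimit of sheaves is computed
sectionwise).
[cite: Hartshorne1977, II Ex. 1.11] -/
def preservesColimitsOfShape_sheafToPresheaf : Prop :=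
  ∀ (X : TopCat.{u}) [NoetherianSpace X] (A : Type u) [Preorder A] [IsDirected A (· ≤ ·)]
    [Nonempty A],
    PreservesColimitsOfShape A (sheafToPresheaf (Opens.grothendieckTopology X) AddCommGrpCat.{u})

/-- **Hartshorne III.2.8**: on a noetherian topological space, a direct limit (colimit over a
directed set) of flasque sheaves is flasque.
[cite: Hartshorne1977, III.2.8] -/
def isFlasque_colimit : Prop :=
  ∀ (X : TopCat.{u}) [NoetherianSpace X] (A : Type u) [Preorder A] [IsDirected A (· ≤ ·)]
    [Nonempty A] (F : A ⥤ TopCat.Sheaf AddCommGrpCat.{u} X) [∀ a, (F.obj a).IsFlasque]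
    (c : Cocone F), IsColimit c → c.pt.IsFlasque

/-- **Hartshorne III.2.9**: on a noetherian topological space `X`, for a direct system `(ℱ_α)` of
abelian sheaves indexed by a directed set, the natural maps `lim→ H^i(X, ℱ_α) → H^i(X, lim→ ℱ_α)`
are isomorphisms for all `i ≥ 0`; stated as: the cohomology functors `H^i(X, ·)`
(Mathlib's `Sheaf.functorH`) preserve colimits indexed by directed sets.
[cite: Hartshorne1977, III.2.9] -/
def preservesColimitsOfShape_functorH : Prop :=
  ∀ (X : TopCat.{u}) [NoetherianSpace X] (A : Type u) [Preorder A] [IsDirected A (· ≤ ·)]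
    [Nonempty A] (i : ℕ),
    PreservesColimitsOfShape A (Sheaf.functorH.{u} (Opens.grothendieckTopology X) i)

/-- **Hartshorne III.2.10**: if `j : Y ↪ X` is the inclusion of a closed subset and `ℱ` is a sheaf of
abelian groups on `Y`, then `H^i(Y, ℱ) = H^i(X, j_* ℱ)` for all `i` (stated as the existence of an
isomorphism of abelian groups; `j_*` is Mathlib's `TopCat.Sheaf.pushforward`).
[cite: Hartshorne1977, III.2.10] -/
def H_pushforward_of_isClosedEmbedding : Prop :=
  ∀ (X Y : TopCat.{u}) (j : Y ⟶ X), Topology.IsClosedEmbedding j →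
    ∀ (F : TopCat.Sheaf AddCommGrpCat.{u} Y) (i : ℕ),
      Nonempty (F.H i ≃+ ((TopCat.Sheaf.pushforward AddCommGrpCat.{u} j).obj F).H i)

/-- **Grothendieck's vanishing theorem** (Hartshorne III.2.7; Grothendieck, Tôhoku 3.6.5): let `X` be a
noetherian topological space of dimension `n`; then `H^i(X, ℱ) = 0` for all `i > n` and all sheaves of
abelian groups `ℱ` on `X`. Here `dim X` is `topologicalKrullDim X` (so the hypothesis reads
`topologicalKrullDim X < i`, which for nonempty `X` of finite dimension `n` is `i > n`, and is vacuous
for infinite-dimensional `X`), and `H^i(X, ℱ)` is Mathlib's `Sheaf.H ℱ i`.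
[cite: Hartshorne1977, III.2.7] -/
def grothendieckVanishing : Prop :=
  ∀ (X : TopCat.{u}) [NoetherianSpace X] (F : TopCat.Sheaf AddCommGrpCat.{u} X) (i : ℕ),
    topologicalKrullDim X < i → Subsingleton (F.H i)

end Literature.AlgebraicGeometry.Motives
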